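import Mathlib
import HarnessLib
import Summits.RiemannHypothesis.RiemannHypothesis.Theorems.PfPersistenceFfDialPrefix
import Summits.RiemannHypothesis.RiemannHypothesis.Theorems.MotivicDoorFfDoor

/-!
# Function-field mirror: the HANDOVER DEPTH of the window tower (door D-E)
(pub-rhpf, seat ffmirror-2; HONEST FRAMING: mechanism/rigidity campaign — no RH claims)

Companion to `PfPersistenceFfDialPrefix` (the direction coefficients ↦ windows).  This file proves
the converse direction windows ↦ coefficients and pins down EXACTLY how deep a window must be before
it determines the datum.  Recall (pub-weilobs `FF.md` §1; `PfPersistenceFfAngleTwin`): a datum is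
`(q, h)`, `h ∈ ℤ[X]` the characteristic polynomial of Frobenius (monic, degree `2g`), and the window
form of the degree window `M` is the Toeplitz matrix `T_M(q, h) = (K(|m - m'|))_{0 ≤ m, m' ≤ M}`,
`K(n) = s_n / (2 (√q)^n)`, `s_n` the power sums of the roots.

* NEWTON, the direction `s ↦ e` (`esymm_eq_of_powerSum_eq`): the first `m` power sums of a multiset
  determine its first `m` elementary symmetric functions (characteristic `0`; no cardinality
  hypothesis).
* `T_M` carries `K(0), …, K(M)` in its first row, hence at `0 < q` the power sums `s_0, …, s_M`
  (`powerSum_eq_of_ffWindowForm_eq`), hence `#A` and `e_1, …, e_M`.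
* HANDOVER, plain form (`eq_of_ffWindowForm_eq`, `eq_of_weilWindowForm_eq`): at known `q > 0`, ONE
  window with `M ≥ #A` determines the root multiset `A`; one window with `M ≥ deg h` determines the
  monic polynomial `h` — with NO Riemann hypothesis and NO functional equation assumed.  The threshold
  is exact (`weilWindowForm_add_C`: a constant shift is invisible to every `T_M`, `M + 1 ≤ deg h`;
  `weilWindowForm_injOn_iff`: `h ↦ T_M(q, h)` is injective on monic polynomials of degree `d` iff
  `d ≤ M`).
* HANDOVER UNDER THE FUNCTIONAL EQUATION (`eq_of_weilWindowForm_eq_of_fe`): for monic `h` of degree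
  `2g` with the coefficient functional equation `q^g h_j = q^i h_i` (`i + j = 2g`; the spelling of
  pub-rhdoor ff-1's `MotivicDoorFfWeilConverse`), already the window `M = g` — an INFORMATIVE window —
  determines `h`: `T_g` gives `e_1, …, e_g`, i.e. the top half of the coefficients, and the functional
  equation reflects them onto the bottom half.  The threshold `g` is exact: below it the middle dial
  `h ↦ h + k x^g` of `PfPersistenceFfDialPrefix` preserves the functional equation (pub-rhdoor ff-1's
  `MotivicDoor.FunctionField.fe_dial`, imported) and is invisible (`weilWindowForm_dial`), so
  `h ↦ T_M(q, h)` is injective on the FE class iff `g ≤ M` (`weilWindowForm_injOn_fe_iff`), and EVERY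
  member of the class has a collision partner below depth `g` (`exists_fe_collision_below`).
* SHARPNESS OF THE FF-DOOR DEPTH (`exists_finiteWindowReader_pinning`): pub-rhdoor ff-1's
  `finiteWindow_matched_by_rhFalse` (`MotivicDoorFfDoor`) says that a reader of the windows `T_0, …, T_M`
  with `M + 1 ≤ g` that accepts one honest datum of dimension `g` accepts an honest RH-false one; the
  bound is sharp — at `M = g` the finite-window reader 'the windows `T_0, …, T_g` are those of `h₀`'
  accepts `h₀` and NO other honest datum of dimension `g`.
* DOOR READING (`exists_windowReader_of_predicate` / `not_exists_windowReader_middleCoeff_below`): at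
  known `q` and depth `M ≥ g`, EVERY predicate of the FE datum `(q, h)` — in particular 'is the
  characteristic polynomial of Frobenius of an abelian variety over `F_q`' (Honda–Tate; cited, never
  formalised here) — IS a functional of the single window `T_M`; below depth `g` not even the middle
  coefficient is.  So on FE data the blindness statements of the cell's door ledger (E-MOT: scale-free
  readers `scaleInvariant_eq_of_pow`, convex informative-window readers `convexReader_accepts_of_neighbours`,
  cross-`q` twins `weilTowerFunctional_eq_of_twin`) are statements about READER CLASSES or about hidden
  `q`, never about the information content of the windows `M ≥ g`; the residual separator of honest
  fakes from genuine objects at depth `≥ g` is an arithmetic predicate of `(q, h)`.  Contrast with door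
  D-D (`PfPersistenceFfWeilCriterion`): POSITIVITY of a window decides `RH(q, h)` only from depth
  `2g - 1` on (sharp, `PfPersistenceFfWeilCriterionSharp`), although the datum itself is already handed
  over at depth `g`.

Pure algebra, [folklore]: Newton's identities (`Literature.Analysis.Complex.SCV.natCast_mul_esymm_eq_sum`)
and Vieta (`Multiset.prod_X_sub_X_eq_sum_esymm`, `Polynomial.coeff_eq_esymm_roots_of_card`).
-/

set_option linter.dupNamespace false  -- the mandated namespace repeats `RiemannHypothesis`

noncomputable section

open Polynomial Finset
open Summit.RiemannHypothesis.RiemannHypothesis.Theorems.MotivicDoor.FunctionField (fe_dial)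

namespace Summit.RiemannHypothesis.RiemannHypothesis.Theorems.PfPersistence.FfAngleTwin

/-! ## Newton: the first `m` elementary symmetric functions are determined by the first `m` power sums -/

/-- NEWTON (multiset form, the direction `s ↦ e`): if `s_k(A) = s_k(A')` for `1 ≤ k ≤ m` then
`e_k(A) = e_k(A')` for every `k ≤ m` (strong induction on `k` through
`k e_k = (-1)^{k+1} Σ_{i<k} (-1)^i e_i s_{k-i}`; no hypothesis on the cardinalities). [folklore] -/
theorem esymm_eq_of_powerSum_eq {A A' : Multiset ℂ} {m : ℕ}
    (hs : ∀ k, 1 ≤ k → k ≤ m → powerSum A k = powerSum A' k) :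
    ∀ k, k ≤ m → A.esymm k = A'.esymm k := by
  intro k
  induction k using Nat.strong_induction_on with
  | _ k ih =>
    intro hkm
    rcases Nat.eq_zero_or_pos k with rfl | hk
    · rw [multiset_esymm_zero, multiset_esymm_zero]
    have h1 := Literature.Analysis.Complex.SCV.natCast_mul_esymm_eq_sum A k
    have h2 := Literature.Analysis.Complex.SCV.natCast_mul_esymm_eq_sum A' k
    have hsum : ∑ a ∈ (antidiagonal k).filter (fun a => a.1 < k),
          (-1) ^ a.1 * A.esymm a.1 * (A.map (· ^ a.2)).sum
        = ∑ a ∈ (antidiagonal k).filter (fun a => a.1 < k),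
          (-1) ^ a.1 * A'.esymm a.1 * (A'.map (· ^ a.2)).sum := by
      refine sum_congr rfl (fun a ha => ?_)
      rw [mem_filter, HasAntidiagonal.mem_antidiagonal] at ha
      obtain ⟨hak, hlt⟩ := ha
      have he : A.esymm a.1 = A'.esymm a.1 := ih a.1 hlt (by omega)
      have hps : powerSum A a.2 = powerSum A' a.2 := hs a.2 (by omega) (by omega)
      simp only [powerSum] at hps
      rw [he, hps]
    rw [hsum, ← h2] at h1
    have hk0 : (k : ℂ) ≠ 0 := Nat.cast_ne_zero.mpr (by omega)
    exact mul_left_cancel₀ hk0 h1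

/-! ## The window form hands over the power sums -/

/-- The first row of `T_M` is `(K(0), …, K(M))`. [folklore] -/
theorem ffWindowForm_zero_apply (q : ℝ) (A : Multiset ℂ) {M n : ℕ} (hn : n ≤ M) :
    ffWindowForm q A M ⟨0, Nat.succ_pos M⟩ ⟨n, Nat.lt_succ_of_le hn⟩ = ffKernel q A n := by
  simp [ffWindowForm, Matrix.of_apply, Nat.dist]

/-- `T_M(q, A) = T_M(q, A')` ⇒ `K_A(n) = K_{A'}(n)` for `n ≤ M`. [folklore] -/
theorem ffKernel_eq_of_ffWindowForm_eq {q : ℝ} {A A' : Multiset ℂ} {M : ℕ}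
    (hT : ffWindowForm q A M = ffWindowForm q A' M) {n : ℕ} (hn : n ≤ M) :
    ffKernel q A n = ffKernel q A' n := by
  rw [← ffWindowForm_zero_apply q A hn, ← ffWindowForm_zero_apply q A' hn, hT]

/-- `T_M` knows `#A` (its diagonal is `K(0) = #A / 2`; any `q`). [folklore] -/
theorem card_eq_of_ffWindowForm_eq {q : ℝ} {A A' : Multiset ℂ} {M : ℕ}
    (hT : ffWindowForm q A M = ffWindowForm q A' M) : Multiset.card A = Multiset.card A' := by
  have h := ffKernel_eq_of_ffWindowForm_eq hT (Nat.zero_le M)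
  rw [ffKernel_zero, ffKernel_zero, div_left_inj' two_ne_zero] at h
  exact_mod_cast h

/-- At `0 < q` the window form `T_M` hands over the power sums `s_0, …, s_M` of the roots
(`s_n = 2 (√q)^n K(n)`). [folklore] -/
theorem powerSum_eq_of_ffWindowForm_eq {q : ℝ} (hq : 0 < q) {A A' : Multiset ℂ} {M : ℕ}
    (hT : ffWindowForm q A M = ffWindowForm q A' M) {n : ℕ} (hn : n ≤ M) :
    powerSum A n = powerSum A' n := by
  have h := ffKernel_eq_of_ffWindowForm_eq hT hn
  rw [ffKernel_eq, ffKernel_eq] at h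
  have hc : (2 * (Real.sqrt q : ℂ) ^ n) ≠ 0 := by
    refine mul_ne_zero two_ne_zero (pow_ne_zero _ ?_)
    exact_mod_cast (Real.sqrt_pos.mpr hq).ne'
  rwa [div_left_inj' hc] at h

/-- … hence the elementary symmetric functions `e_0, …, e_M` of the roots. [folklore] -/
theorem esymm_eq_of_ffWindowForm_eq {q : ℝ} (hq : 0 < q) {A A' : Multiset ℂ} {M : ℕ}
    (hT : ffWindowForm q A M = ffWindowForm q A' M) : ∀ k, k ≤ M → A.esymm k = A'.esymm k :=
  esymm_eq_of_powerSum_eq (fun _ _ hk => powerSum_eq_of_ffWindowForm_eq hq hT hk)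

/-! ## Handover, plain form: depth `#A` (resp. `deg h`) -/

/-- HANDOVER (multiset level): at known `q > 0`, ONE window `T_M` with `M ≥ #A` determines the root
multiset `A` — no Riemann hypothesis, no functional equation. [folklore] -/
theorem eq_of_ffWindowForm_eq {q : ℝ} (hq : 0 < q) {A A' : Multiset ℂ} {M : ℕ}
    (hM : Multiset.card A ≤ M) (hT : ffWindowForm q A M = ffWindowForm q A' M) : A = A' := by
  have hcard : Multiset.card A' = Multiset.card A := (card_eq_of_ffWindowForm_eq hT).symm
  have hes := esymm_eq_of_ffWindowForm_eq hq hT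
  have hpp : (A.map fun a => X - C a).prod = (A'.map fun a => X - C a).prod := by
    rw [Multiset.prod_X_sub_X_eq_sum_esymm, Multiset.prod_X_sub_X_eq_sum_esymm, hcard]
    refine sum_congr rfl (fun j hj => ?_)
    rw [mem_range] at hj
    rw [hes j (by omega)]
  have h := congrArg Polynomial.roots hpp
  simpa only [Polynomial.roots_multiset_prod_X_sub_C] using h

/-- `#(roots of h over ℂ) = deg h` for monic `h`, in the spelling `(h.map _).roots`. [folklore] -/
theorem card_roots_map_of_monic {h : ℤ[X]} (hh : h.Monic) :
    Multiset.card (h.map (Int.castRingHom ℂ)).roots = (h.map (Int.castRingHom ℂ)).natDegree := by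
  rw [hh.natDegree_map]; exact card_frobRoots hh

/-- HANDOVER AT DEPTH `deg h` (door D-E, plain form): at known `q > 0`, one window `T_M` with
`M ≥ deg h` determines the monic integer polynomial `h` outright. [folklore] -/
theorem eq_of_weilWindowForm_eq {q : ℝ} (hq : 0 < q) {h h' : ℤ[X]} (hh : h.Monic) (hh' : h'.Monic)
    {M : ℕ} (hM : h.natDegree ≤ M) (hT : weilWindowForm q h M = weilWindowForm q h' M) : h = h' := by
  have hroots : frobRoots h = frobRoots h' :=
    eq_of_ffWindowForm_eq hq (by rw [card_frobRoots hh]; exact hM) hT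
  apply Polynomial.map_injective (Int.castRingHom ℂ) Int.cast_injective
  have e1 := prod_multiset_X_sub_C_of_monic_of_roots_card_eq (hh.map (Int.castRingHom ℂ))
    (card_roots_map_of_monic hh)
  have e2 := prod_multiset_X_sub_C_of_monic_of_roots_card_eq (hh'.map (Int.castRingHom ℂ))
    (card_roots_map_of_monic hh')
  rw [← e1, ← e2]
  show ((frobRoots h).map fun a => X - C a).prod = ((frobRoots h').map fun a => X - C a).prod
  rw [hroots]

/-- `T_M` also hands over the DEGREE of a monic `h` (`K(0) = deg h / 2`). [folklore] -/
theorem natDegree_eq_of_weilWindowForm_eq {q : ℝ} {h h' : ℤ[X]} (hh : h.Monic) (hh' : h'.Monic)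
    {M : ℕ} (hT : weilWindowForm q h M = weilWindowForm q h' M) : h.natDegree = h'.natDegree := by
  rw [← card_frobRoots hh, ← card_frobRoots hh']
  exact card_eq_of_ffWindowForm_eq hT

/-- A constant shift of a monic `h` of positive degree is monic of the same degree. [folklore] -/
theorem monic_add_C {h : ℤ[X]} (hh : h.Monic) (hd : 1 ≤ h.natDegree) (c : ℤ) :
    (h + C c).Monic ∧ (h + C c).natDegree = h.natDegree := by
  have hlt : (C c).degree < h.degree := by
    refine degree_C_le.trans_lt ?_
    rw [degree_eq_natDegree hh.ne_zero]
    exact_mod_cast hd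
  exact ⟨hh.add_of_left hlt, natDegree_add_eq_left_of_degree_lt hlt⟩

/-- SHARPNESS of the plain handover: the constant shift `h ↦ h + c` is invisible to every window
`T_M` with `M + 1 ≤ deg h` (it moves only `e_{deg h}`, which first enters `s_{deg h}`). [folklore] -/
theorem weilWindowForm_add_C (q : ℝ) {h : ℤ[X]} (hh : h.Monic) (c : ℤ) {M : ℕ}
    (hM : M + 1 ≤ h.natDegree) : weilWindowForm q (h + C c) M = weilWindowForm q h M := by
  obtain ⟨hmon, hdeg⟩ := monic_add_C hh (le_trans (Nat.le_add_left 1 M) hM) c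
  refine weilWindowForm_eq_of_coeff_eq q hmon hh hdeg (m := h.natDegree - 1) ?_ (by omega)
  intro k hk1 hkm hkn
  rw [hdeg] at hkn ⊢
  rw [coeff_add, coeff_C, if_neg (by omega), add_zero]

/-- `h + c ≠ h` for `c ≠ 0`. [folklore] -/
theorem add_C_ne (h : ℤ[X]) {c : ℤ} (hc : c ≠ 0) : h + C c ≠ h := by
  intro heq
  have h1 : C c = (0 : ℤ[X]) := add_left_cancel (heq.trans (add_zero h).symm)
  exact hc (C_eq_zero.mp h1)

/-- HANDOVER DEPTH, plain form (exact threshold): at known `q > 0` the map `h ↦ T_M(q, h)` is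
injective on the monic integer polynomials of degree `d` if and only if `d ≤ M`. [folklore] -/
theorem weilWindowForm_injOn_iff {q : ℝ} (hq : 0 < q) (d M : ℕ) :
    Set.InjOn (fun h : ℤ[X] => weilWindowForm q h M) {h | h.Monic ∧ h.natDegree = d} ↔ d ≤ M := by
  constructor
  · intro hinj
    by_contra hle
    have hlt : M < d := not_le.mp hle
    have h1 : (X ^ d : ℤ[X]) ∈ {h : ℤ[X] | h.Monic ∧ h.natDegree = d} :=
      ⟨monic_X_pow d, natDegree_X_pow d⟩
    have hd : 1 ≤ (X ^ d : ℤ[X]).natDegree := by rw [natDegree_X_pow]; omega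
    obtain ⟨hmon, hdeg⟩ := monic_add_C (monic_X_pow d) hd 1
    have h2 : (X ^ d + C 1 : ℤ[X]) ∈ {h : ℤ[X] | h.Monic ∧ h.natDegree = d} :=
      ⟨hmon, by rw [hdeg, natDegree_X_pow]⟩
    have heq := hinj h2 h1
      (weilWindowForm_add_C q (monic_X_pow d) 1 (by rw [natDegree_X_pow]; omega))
    exact add_C_ne (X ^ d) one_ne_zero heq
  · intro hdM a ha b hb hab
    exact eq_of_weilWindowForm_eq hq ha.1 hb.1 (ha.2 ▸ hdM) hab

/-! ## Handover under the functional equation: depth `g` -/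

/-- HANDOVER AT DEPTH `g` UNDER THE FUNCTIONAL EQUATION (door D-E, FE form): for monic `h, h'` of
degree `2g` satisfying the coefficient functional equation at `q` (pub-rhdoor ff-1's spelling), ONE
window `T_M(q, ·)` with `M ≥ g` — an informative window — decides equality: `T_M` hands over
`e_1, …, e_g`, i.e. the coefficients of `x^{2g-1}, …, x^g`, and the functional equation reflects them
onto the lower half. [folklore] -/
theorem eq_of_weilWindowForm_eq_of_fe {q : ℕ} (hq : 0 < q) {h h' : ℤ[X]} {g : ℕ}
    (hh : h.Monic) (hh' : h'.Monic) (hdeg : h.natDegree = 2 * g) (hdeg' : h'.natDegree = 2 * g)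
    (hFE : ∀ i j, i + j = 2 * g → (q : ℤ) ^ g * h.coeff j = (q : ℤ) ^ i * h.coeff i)
    (hFE' : ∀ i j, i + j = 2 * g → (q : ℤ) ^ g * h'.coeff j = (q : ℤ) ^ i * h'.coeff i)
    {M : ℕ} (hM : g ≤ M) (hT : weilWindowForm (q : ℝ) h M = weilWindowForm (q : ℝ) h' M) :
    h = h' := by
  have hq' : (0 : ℝ) < (q : ℝ) := Nat.cast_pos.mpr hq
  have hes := esymm_eq_of_ffWindowForm_eq hq' hT
  -- the top half of the coefficients agrees
  have htop : ∀ i, g ≤ i → i ≤ 2 * g → h.coeff i = h'.coeff i := by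
    intro i hgi hi2
    have e1 := Polynomial.coeff_eq_esymm_roots_of_card (card_roots_map_of_monic hh) (k := i)
      (by rw [hh.natDegree_map, hdeg]; exact hi2)
    have e2 := Polynomial.coeff_eq_esymm_roots_of_card (card_roots_map_of_monic hh') (k := i)
      (by rw [hh'.natDegree_map, hdeg']; exact hi2)
    rw [(hh.map _).leadingCoeff, hh.natDegree_map, hdeg] at e1
    rw [(hh'.map _).leadingCoeff, hh'.natDegree_map, hdeg'] at e2
    have he : (h.map (Int.castRingHom ℂ)).roots.esymm (2 * g - i)
        = (h'.map (Int.castRingHom ℂ)).roots.esymm (2 * g - i) := hes (2 * g - i) (by omega)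
    rw [he, ← e2, Polynomial.coeff_map, Polynomial.coeff_map] at e1
    simpa only [eq_intCast, Int.cast_inj] using e1
  -- the functional equation reflects it onto the lower half
  ext i
  by_cases hi2 : i ≤ 2 * g
  · by_cases hgi : g ≤ i
    · exact htop i hgi hi2
    · have h1 := hFE (2 * g - i) i (by omega)
      have h2 := hFE' (2 * g - i) i (by omega)
      rw [htop (2 * g - i) (by omega) (by omega), ← h2] at h1
      have hqg : (q : ℤ) ^ g ≠ 0 := pow_ne_zero _ (by exact_mod_cast hq.ne')
      exact mul_left_cancel₀ hqg h1
  · rw [coeff_eq_zero_of_natDegree_lt (by omega), coeff_eq_zero_of_natDegree_lt (by omega)]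

/-- `h + k x^g ≠ h` for `k ≠ 0`. [folklore] -/
theorem dial_ne (h : ℤ[X]) (g : ℕ) {k : ℤ} (hk : k ≠ 0) : h + C k * X ^ g ≠ h := by
  intro heq
  have h1 : C k * X ^ g = (0 : ℤ[X]) := add_left_cancel (heq.trans (add_zero h).symm)
  rw [mul_eq_zero, C_eq_zero] at h1
  rcases h1 with h1 | h1
  · exact hk h1
  · exact pow_ne_zero g X_ne_zero h1

/-- SHARPNESS of depth `g` under FE, pointwise form: EVERY monic FE datum `h` of degree `2g ≥ 2` has a
collision partner in the class — `h + x^g`: distinct, monic of degree `2g`, FE — with the same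
windows `T_M` for all `M + 1 ≤ g`. [folklore] -/
theorem exists_fe_collision_below (q : ℕ) {h : ℤ[X]} {g : ℕ} (hh : h.Monic)
    (hdeg : h.natDegree = 2 * g) (hg : 1 ≤ g)
    (hFE : ∀ i j, i + j = 2 * g → (q : ℤ) ^ g * h.coeff j = (q : ℤ) ^ i * h.coeff i) :
    ∃ h' : ℤ[X], h' ≠ h ∧ h'.Monic ∧ h'.natDegree = 2 * g ∧
      (∀ i j, i + j = 2 * g → (q : ℤ) ^ g * h'.coeff j = (q : ℤ) ^ i * h'.coeff i) ∧
      ∀ M, M + 1 ≤ g → weilWindowForm (q : ℝ) h' M = weilWindowForm (q : ℝ) h M := by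
  obtain ⟨hmon, hdeg'⟩ := monic_dial hh hdeg hg 1
  exact ⟨h + C 1 * X ^ g, dial_ne h g one_ne_zero, hmon, hdeg', fe_dial hFE 1,
    fun M hM => weilWindowForm_dial (q : ℝ) hh hdeg 1 hM⟩

/-- The simplest FE datum of degree `2g`: `x^{2g} + q^g` (RH-true, all roots of modulus `√q` — not
needed here). [folklore] -/
theorem fe_X_pow_add_C (q : ℕ) {g : ℕ} (hg : 1 ≤ g) :
    (X ^ (2 * g) + C ((q : ℤ) ^ g) : ℤ[X]).Monic ∧
    (X ^ (2 * g) + C ((q : ℤ) ^ g) : ℤ[X]).natDegree = 2 * g ∧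
    ∀ i j, i + j = 2 * g → (q : ℤ) ^ g * (X ^ (2 * g) + C ((q : ℤ) ^ g) : ℤ[X]).coeff j
      = (q : ℤ) ^ i * (X ^ (2 * g) + C ((q : ℤ) ^ g) : ℤ[X]).coeff i := by
  have hd : 1 ≤ (X ^ (2 * g) : ℤ[X]).natDegree := by rw [natDegree_X_pow]; omega
  obtain ⟨hmon, hdeg⟩ := monic_add_C (monic_X_pow (2 * g)) hd ((q : ℤ) ^ g)
  refine ⟨hmon, by rw [hdeg, natDegree_X_pow], ?_⟩
  intro i j hij
  simp only [coeff_add, coeff_X_pow, coeff_C]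
  have h2g : 2 * g ≠ 0 := by omega
  by_cases hj0 : j = 0
  · have hi : i = 2 * g := by omega
    rw [if_neg (by omega : ¬ j = 2 * g), if_pos hj0, if_pos hi, if_neg (by omega : ¬ i = 0), hi]
    ring
  · by_cases hj2 : j = 2 * g
    · have hi : i = 0 := by omega
      rw [if_pos hj2, if_neg hj0, if_neg (by omega : ¬ i = 2 * g), if_pos hi, hi]
      ring
    · rw [if_neg hj2, if_neg hj0, if_neg (by omega : ¬ i = 2 * g), if_neg (by omega : ¬ i = 0)]
      ring

/-- HANDOVER DEPTH UNDER THE FUNCTIONAL EQUATION (exact threshold): at known `q > 0`, `g ≥ 1`, the map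
`h ↦ T_M(q, h)` is injective on the monic FE polynomials of degree `2g` if and only if `g ≤ M`.
(`⇐`: `eq_of_weilWindowForm_eq_of_fe`; `⇒`: the dial of `x^{2g} + q^g`.) [folklore] -/
theorem weilWindowForm_injOn_fe_iff {q : ℕ} (hq : 0 < q) {g : ℕ} (hg : 1 ≤ g) (M : ℕ) :
    Set.InjOn (fun h : ℤ[X] => weilWindowForm (q : ℝ) h M)
      {h : ℤ[X] | h.Monic ∧ h.natDegree = 2 * g ∧
        ∀ i j, i + j = 2 * g → (q : ℤ) ^ g * h.coeff j = (q : ℤ) ^ i * h.coeff i} ↔ g ≤ M := by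
  constructor
  · intro hinj
    by_contra hle
    have hlt : M < g := not_le.mp hle
    obtain ⟨hmon, hdeg, hFE⟩ := fe_X_pow_add_C q hg
    obtain ⟨h', hne, hmon', hdeg', hFE', hwin⟩ := exists_fe_collision_below q hmon hdeg hg hFE
    exact hne (hinj ⟨hmon', hdeg', hFE'⟩ ⟨hmon, hdeg, hFE⟩ (hwin M (by omega)))
  · intro hgM a ha b hb hab
    exact eq_of_weilWindowForm_eq_of_fe hq ha.1 hb.1 ha.2.1 hb.2.1 ha.2.2 hb.2.2 hgM hab

/-- SHARPNESS OF THE FF-DOOR DEPTH (complement to pub-rhdoor ff-1's `finiteWindow_matched_by_rhFalse`,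
whose hypothesis is `M + 1 ≤ g`): at depth `M = g` the FINITE-WINDOW reader (in ff-1's sense: it depends
on `T_0, …, T_g` only) 'the windows `T_0, …, T_g` are those of `(q, h₀)`' accepts `h₀` and pins the datum —
every honest (monic, degree `2g`, FE) `h` it accepts IS `h₀`; so when `h₀` is RH-true it accepts no
RH-false honest datum of dimension `g`, and ff-1's bound cannot be raised to `M = g`. [folklore] -/
theorem exists_finiteWindowReader_pinning {q : ℕ} (hq : 0 < q) (g : ℕ) (h₀ : ℤ[X]) :
    ∃ Φ : Tower → Prop, (∀ T T' : Tower, (∀ M' ≤ g, T M' = T' M') → Φ T → Φ T') ∧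
      Φ (weilWindowTower (q : ℝ) h₀) ∧
      ∀ h : ℤ[X], h₀.Monic → h₀.natDegree = 2 * g →
        (∀ i j, i + j = 2 * g → (q : ℤ) ^ g * h₀.coeff j = (q : ℤ) ^ i * h₀.coeff i) →
        h.Monic → h.natDegree = 2 * g →
        (∀ i j, i + j = 2 * g → (q : ℤ) ^ g * h.coeff j = (q : ℤ) ^ i * h.coeff i) →
        Φ (weilWindowTower (q : ℝ) h) → h = h₀ := by
  refine ⟨fun T => ∀ M' ≤ g, T M' = weilWindowTower (q : ℝ) h₀ M', ?_, fun M' _ => rfl, ?_⟩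
  · intro T T' hTT' hT M' hM'
    rw [← hTT' M' hM', hT M' hM']
  · intro h hh₀ hdeg₀ hFE₀ hh hdeg hFE hΦ
    exact eq_of_weilWindowForm_eq_of_fe hq hh hh₀ hdeg hdeg₀ hFE hFE₀ le_rfl (hΦ g le_rfl)

/-! ## Door reading: above depth `g` every predicate is a window reader; below, not even the middle coefficient -/

/-- DOOR D-E (function-field side, FE data): at known `q > 0` and depth `M ≥ g`, EVERY predicate `P`
of the datum is a functional of the single window `T_M` on the monic FE class of degree `2g` — in
particular the arithmetic predicate 'geometric origin' (Honda–Tate; cited, not formalised) is, there,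
a window reader.  Blindness at depth `≥ g` is therefore always a statement about a reader CLASS. [folklore] -/
theorem exists_windowReader_of_predicate {q : ℕ} (hq : 0 < q) {g M : ℕ} (hM : g ≤ M)
    (P : ℤ[X] → Prop) :
    ∃ Φ : Matrix (Fin (M + 1)) (Fin (M + 1)) ℂ → Prop, ∀ h : ℤ[X], h.Monic → h.natDegree = 2 * g →
      (∀ i j, i + j = 2 * g → (q : ℤ) ^ g * h.coeff j = (q : ℤ) ^ i * h.coeff i) →
      (P h ↔ Φ (weilWindowForm (q : ℝ) h M)) := by
  refine ⟨fun T => ∃ h' : ℤ[X], h'.Monic ∧ h'.natDegree = 2 * g ∧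
    (∀ i j, i + j = 2 * g → (q : ℤ) ^ g * h'.coeff j = (q : ℤ) ^ i * h'.coeff i) ∧
    weilWindowForm (q : ℝ) h' M = T ∧ P h', ?_⟩
  intro h hh hdeg hFE
  constructor
  · intro hP; exact ⟨h, hh, hdeg, hFE, rfl, hP⟩
  · rintro ⟨h', hh', hdeg', hFE', hT, hP'⟩
    rwa [eq_of_weilWindowForm_eq_of_fe hq hh' hh hdeg' hdeg hFE' hFE hM hT] at hP'

/-- … whereas below depth `g` (`M + 1 ≤ g`) NO functional of `T_M` reads even the middle coefficient
`h_g` on that class (the dial moves `h_g` and fixes `T_M`). [folklore] -/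
theorem not_exists_windowReader_middleCoeff_below {q : ℕ} {g M : ℕ} (hg : 1 ≤ g) (hM : M + 1 ≤ g)
    (c : ℤ) :
    ¬ ∃ Φ : Matrix (Fin (M + 1)) (Fin (M + 1)) ℂ → Prop, ∀ h : ℤ[X], h.Monic → h.natDegree = 2 * g →
      (∀ i j, i + j = 2 * g → (q : ℤ) ^ g * h.coeff j = (q : ℤ) ^ i * h.coeff i) →
      (h.coeff g = c ↔ Φ (weilWindowForm (q : ℝ) h M)) := by
  rintro ⟨Φ, hΦ⟩
  -- start from x^{2g} + q^g and dial its middle coefficient to c, then to c + 1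
  obtain ⟨hmon₀, hdeg₀, hFE₀⟩ := fe_X_pow_add_C q hg
  set h₀ : ℤ[X] := X ^ (2 * g) + C ((q : ℤ) ^ g) with hh₀
  have hmid₀ : h₀.coeff g = 0 := by
    rw [hh₀, coeff_add, coeff_X_pow, coeff_C, if_neg (by omega), if_neg (by omega), add_zero]
  obtain ⟨hmon₁, hdeg₁⟩ := monic_dial hmon₀ hdeg₀ hg c
  have hFE₁ := fe_dial hFE₀ c
  have hmid₁ : (h₀ + C c * X ^ g).coeff g = c := by
    rw [coeff_add, coeff_C_mul_X_pow, if_pos rfl, hmid₀, zero_add]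
  obtain ⟨hmon₂, hdeg₂⟩ := monic_dial hmon₁ hdeg₁ hg 1
  have hFE₂ := fe_dial hFE₁ 1
  have hmid₂ : (h₀ + C c * X ^ g + C 1 * X ^ g).coeff g = c + 1 := by
    rw [coeff_add, coeff_C_mul_X_pow, if_pos rfl, hmid₁]
  have hwin : weilWindowForm (q : ℝ) (h₀ + C c * X ^ g + C 1 * X ^ g) M
      = weilWindowForm (q : ℝ) (h₀ + C c * X ^ g) M := weilWindowForm_dial (q : ℝ) hmon₁ hdeg₁ 1 hM
  have h1 : Φ (weilWindowForm (q : ℝ) (h₀ + C c * X ^ g) M) := (hΦ _ hmon₁ hdeg₁ hFE₁).1 hmid₁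
  have h2 : (h₀ + C c * X ^ g + C 1 * X ^ g).coeff g = c := (hΦ _ hmon₂ hdeg₂ hFE₂).2 (hwin ▸ h1)
  rw [hmid₂] at h2
  omega

end Summit.RiemannHypothesis.RiemannHypothesis.Theorems.PfPersistence.FfAngleTwin

end
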